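import Literature.RingTheory.KTheory.MilnorKModTwo
import Mathlib.LinearAlgebra.QuadraticForm.IsometryEquiv
import HarnessLib

/-!
# LEMMA 3.1 for binary quadratic modules: the Stiefel–Whitney invariants `w₁, w₂` of `⟨a⟩ ⊕ ⟨b⟩` are isometry
# invariants (Milnor, *Algebraic K-theory and quadratic forms*, Invent. Math. 9 (1970), §3)

Family `hodge`, lane `lit-hodgefound` (foundations library; seat `lit-hodgefound-p27`, generation 40, row g40-#10);
topic `RingTheory/KTheory`.  Sequel of `MilnorKModTwo` (g40-#9: `k_nF = K_nF/2K_nF`, `kSymbol`, `kpair`, the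
invisibility of squares `kSymbol_update_mul_sq`/`kpair_mul_sq_right`, and the rank-`2` computation
`kpair_eq_of_eq_add_sq : α = a x² + b y² ⇒ {a, b} = {α, abα}`, `kSymbol_add_eq_of_eq_add_sq`), with Mathlib's
quadratic forms (`QuadraticMap.weightedSumSquares`, `QuadraticMap.IsometryEquiv`).  DEFINITIONS WITH BODIES (the
`abbrev binaryForm`, `swOne`, `swTwo`) and PROVED THEOREMS; no named fact, no instance, no notation, 0 `sorry`,
net debt 0 (D-0026).

## The source, verbatim

J. Milnor, *Algebraic K-theory and quadratic forms*, Invent. Math. 9 (1970) 318–344 (held `paper:doi-10-1007-bf01425486`;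
bib key `Milnor1970`), §3 (p0010 L33 – p0011 L12): «Let M be a quadratic module over F. That is M is a finite
dimensional vector space with a non-degenerate symmetric bilinear inner product. Then M is isomorphic to an orthogonal
direct sum (a₁) ⊕ ⋯ ⊕ (a_r) of one dimensional modules. […] Define the Stiefel-Whitney invariant w(M) ∈ k_ΠF of a
quadratic module M ≅ (a₁) ⊕ ⋯ ⊕ (a_r) by the formula w(M) = (1 + l(a₁))(1 + l(a₂))⋯(1 + l(a_r)). Thus w(M) can be
written as 1 + w₁(M) + ⋯ + w_r(M) where wᵢ(M), the i-th Stiefel-Whitney invariant, is equal to the i-th elementary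
symmetric function of l(a₁), …, l(a_r) considered as an element of kᵢF. Evidently w₁ is just the classical
"discriminant" of M»; and LEMMA 3.1 with its proof (p0011 L24 – p0012 L6): «The invariant w(M) is a well defined unit
in the ring k_ΠF and satisfies the Whitney sum formula w(M ⊕ N) = w(M)w(N). *Proof.* Just as in the classical proof
that the Hasse-Witt invariant is well defined, it suffices to consider the rank 2 case. (Compare O'Meara
[12, p. 150].) Suppose then that (a) ⊕ (b) ≅ (α), (β). Then the discriminant ab must be equal to αβ multiplied by a
square; or in other words (4) l(a) + l(b) ≡ l(α) + l(β) mod 2K₁F. Furthermore, the equation α = a x² + b y² must have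
a solution x, y ∈ F. […] l(a)l(b) ≡ […] l(α)l(β) mod 2K₂F; which completes the proof.»  (§3 assumes throughout that
«F has characteristic ≠ 2», p0010 L32.)

## What is formalised

The rank-`2` case of LEMMA 3.1 as a statement about Mathlib's quadratic forms: `binaryForm a b` is the diagonal form
`a x² + b y²` on `F²` (`QuadraticMap.weightedSumSquares F ![a, b]`, i.e. the quadratic module `(a) ⊕ (b)`), and
`swOne a b = l(a) + l(b) ∈ k₁F`, `swTwo a b = l(a)l(b) ∈ k₂F` are its Stiefel–Whitney invariants (the elementary
symmetric functions of `l(a), l(b)`).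

* `exists_of_isometryEquiv`: an isometry `(α) ⊕ (β) ≅ (a) ⊕ (b)` over a field of characteristic `≠ 2` yields
  «the equation α = a x² + b y²» and «the discriminant ab […] equal to αβ multiplied by a square» (`αβ = ab·d²` with
  `d` the determinant of the isometry — the computation `(ap² + br²)(aq² + bs²) = ab(ps − qr)² + (apq + brs)²` with
  the cross term `apq + brs = 0`, private `discr_aux`).
* **`sw_eq_of_isometryEquiv`: `(a) ⊕ (b) ≅ (α) ⊕ (β) ⇒ w₁(a, b) = w₁(α, β)` and `w₂(a, b) = w₂(α, β)`** — by the
  rank-`2` computation `kpair_eq_of_eq_add_sq` of `MilnorKModTwo` and the invisibility of squares in `k_*F`.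

Not here: quadratic modules of higher rank, the ring `k_ΠF` and `w(M)` in general (the reduction «it suffices to
consider the rank 2 case» is Witt's chain-equivalence theorem), the Whitney sum formula.

## References

* [Milnor1970] J. Milnor, *Algebraic K-theory and quadratic forms*, Invent. Math. 9 (1970) 318–344 — §3, the
  Stiefel–Whitney invariant (p0010 L33 – p0011 L12), Lemma 3.1 and its proof (p0011 L24 – p0012 L6).

Provenance: lane `lit-hodgefound`, seat `lit-hodgefound-p27` gen 40 (agent `literature-prover-lit-hodgefound-p27-g40-0`),
row g40-#10.
-/

set_option autoImplicit false

noncomputable section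

namespace Literature.RingTheory.KTheory

/-! ### LEMMA 3.1 for binary quadratic modules -/

section StiefelWhitney

variable {F : Type*} [Field F]

namespace MilnorK

open Function QuadraticMap

/-- The binary quadratic module `(a) ⊕ (b)`: the diagonal form `a x² + b y²` on `F²` (Mathlib's `weightedSumSquares`). [cite:
Milnor1970, §3 «M is isomorphic to an orthogonal direct sum (a₁) ⊕ ⋯ ⊕ (a_r) of one dimensional modules» (p0010
L35 – p0011 L1)] -/
abbrev binaryForm (a b : F) : QuadraticForm F (Fin 2 → F) := weightedSumSquares F ![a, b]

/-- `(a) ⊕ (b)` evaluated: `a v₀² + b v₁²`. [cite: Milnor1970, §3 (p0010 L35 – p0011 L1)] -/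
theorem binaryForm_apply (a b : F) (v : Fin 2 → F) : binaryForm a b v = a * v 0 ^ 2 + b * v 1 ^ 2 := by
  rw [binaryForm, weightedSumSquares_apply, Fin.sum_univ_two]
  simp only [Matrix.cons_val_zero, Matrix.cons_val_one, smul_eq_mul, pow_two]

/-- **`w₁((a) ⊕ (b)) = l(a) + l(b) ∈ k₁F`**, the first Stiefel–Whitney invariant («just the classical discriminant»). [cite: Milnor1970, §3, the Stiefel–Whitney invariant «wᵢ(M) […] the i-th elementary symmetric function of l(a₁), …, l(a_r)» (p0011 L1–L12)] -/
def swOne (a b : Fˣ) : Mod2 F 1 := kSymbol (fun _ : Fin 1 => a) + kSymbol (fun _ : Fin 1 => b)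

/-- **`w₂((a) ⊕ (b)) = l(a)l(b) ∈ k₂F`**, the second Stiefel–Whitney invariant. [cite: Milnor1970, §3, the Stiefel–Whitney invariant «wᵢ(M) […] the i-th elementary symmetric function of l(a₁), …, l(a_r)» (p0011 L1–L12)] -/
def swTwo (a b : Fˣ) : Mod2 F 2 := kpair a b

/-- `swOne` unfolded. [cite: Milnor1970, §3, the Stiefel–Whitney invariant «wᵢ(M) […] the i-th elementary symmetric function of l(a₁), …, l(a_r)» (p0011 L1–L12)] -/
theorem swOne_def (a b : Fˣ) : swOne a b = kSymbol (fun _ : Fin 1 => a) + kSymbol (fun _ : Fin 1 => b) := rfl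

/-- `swTwo` unfolded. [cite: Milnor1970, §3, the Stiefel–Whitney invariant «wᵢ(M) […] the i-th elementary symmetric function of l(a₁), …, l(a_r)» (p0011 L1–L12)] -/
theorem swTwo_def (a b : Fˣ) : swTwo a b = kpair a b := rfl

/-- Squares die in `k₁F`: `l(x y²) = l(x)`. [cite: Milnor1970, §3 «k₁F ≅ F•/F•²» (p0010 L31)] -/
theorem kSymbol_const_mul_sq (x y : Fˣ) : kSymbol (fun _ : Fin 1 => x * y ^ 2) = kSymbol (fun _ : Fin 1 => x) := by
  have := kSymbol_update_mul_sq (fun _ : Fin 1 => (1 : Fˣ)) 0 x y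
  simp only [update_eq_const_of_subsingleton] at this
  exact this

/-- The discriminant computation for an isometry of binary forms in characteristic `≠ 2`:
`(ap² + br²)(aq² + bs²) = ab(ps − qr)²` once the cross term `apq + brs` vanishes. [folklore] -/
private theorem discr_aux (h2 : (2 : F) ≠ 0) {a b α β p q r s : F} (h0 : a * p ^ 2 + b * r ^ 2 = α)
    (h1 : a * q ^ 2 + b * s ^ 2 = β) (h01 : a * (p + q) ^ 2 + b * (r + s) ^ 2 = α + β) :
    α * β = a * b * (p * s - q * r) ^ 2 := by
  have hcross : a * p * q + b * r * s = 0 := by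
    have h : 2 * (a * p * q + b * r * s) = 0 := by linear_combination h01 - h0 - h1
    rcases mul_eq_zero.1 h with h | h
    · exact absurd h h2
    · exact h
  linear_combination (-β) * h0 - (a * p ^ 2 + b * r ^ 2) * h1 + (a * p * q + b * r * s) * hcross

/-- **An isometry `(α) ⊕ (β) ≅ (a) ⊕ (b)` (characteristic `≠ 2`) represents `α` as `a x² + b y²` and matches the
discriminants up to a square, `αβ = ab·d²`** («Then the discriminant ab must be equal to αβ multiplied by a square […]
Furthermore, the equation α = a x² + b y² must have a solution x, y ∈ F»). [cite: Milnor1970, §3 Lemma 3.1 and its proof, the rank 2 case (p0011 L24 – p0012 L6)] -/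
theorem exists_of_isometryEquiv (h2 : (2 : F) ≠ 0) (a b α β : F)
    (f : (binaryForm α β).IsometryEquiv (binaryForm a b)) :
    ∃ x y d : F, α = a * x ^ 2 + b * y ^ 2 ∧ α * β = a * b * d ^ 2 := by
  have hv0 : binaryForm α β (Pi.single 0 1) = α := by
    rw [binaryForm_apply]; simp
  have hv1 : binaryForm α β (Pi.single 1 1) = β := by
    rw [binaryForm_apply]; simp
  have hv01 : binaryForm α β (Pi.single 0 1 + Pi.single 1 1) = α + β := by
    rw [binaryForm_apply]; simp
  have h0 := f.map_app (Pi.single 0 1)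
  have h1 := f.map_app (Pi.single 1 1)
  have h01 := f.map_app (Pi.single 0 1 + Pi.single 1 1)
  rw [hv0, binaryForm_apply] at h0
  rw [hv1, binaryForm_apply] at h1
  rw [hv01, map_add, binaryForm_apply, Pi.add_apply, Pi.add_apply] at h01
  exact ⟨_, _, _, h0.symm, discr_aux h2 h0 h1 h01⟩

/-- **LEMMA 3.1 for binary quadratic modules** (characteristic `≠ 2`): if `(a) ⊕ (b) ≅ (α) ⊕ (β)` then
`w₁ = l(a) + l(b) = l(α) + l(β)` in `k₁F` and `w₂ = l(a)l(b) = l(α)l(β)` in `k₂F` — the Stiefel–Whitney invariant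
`w = 1 + w₁ + w₂` of a binary quadratic module does not depend on the diagonalization.  (From
`exists_of_isometryEquiv`, the rank-`2` computation `kpair_eq_of_eq_add_sq` of `MilnorKModTwo`, and the invisibility of
squares: `abα = β·(α/d)²`.) [cite: Milnor1970, §3 Lemma 3.1 and its proof, the rank 2 case (p0011 L24 – p0012 L6)] -/
theorem sw_eq_of_isometryEquiv (h2 : (2 : F) ≠ 0) (a b α β : Fˣ)
    (e : (binaryForm (a : F) b).IsometryEquiv (binaryForm (α : F) β)) :
    swOne a b = swOne α β ∧ swTwo a b = swTwo α β := by
  obtain ⟨x, y, d, hα, hd⟩ := exists_of_isometryEquiv h2 (a : F) b α β e.symm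
  have hd0 : d ≠ 0 := by
    rintro rfl
    rw [zero_pow two_ne_zero, mul_zero, ← Units.val_mul] at hd
    exact (α * β).ne_zero hd
  obtain ⟨du, rfl⟩ : ∃ du : Fˣ, (du : F) = d := ⟨Units.mk0 d hd0, Units.val_mk0 _⟩
  -- `abα = β (α/d)²`
  have hβ : a * b * α = β * (α * du⁻¹) ^ 2 := Units.ext (by
    push_cast
    rw [mul_pow, inv_pow, ← _root_.mul_assoc, eq_mul_inv_iff_mul_eq₀ (pow_ne_zero 2 hd0)]
    linear_combination (-(α : F)) * hd)
  refine ⟨?_, ?_⟩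
  · rw [swOne, swOne, kSymbol_add_eq_of_eq_add_sq a b α, hβ, kSymbol_const_mul_sq]
  · rw [swTwo, swTwo, kpair_eq_of_eq_add_sq a b α x y hα, hβ, kpair_mul_sq_right]

end MilnorK

end StiefelWhitney

end Literature.RingTheory.KTheory

end
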